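import Summits.Schanuel.Schanuel.Theses.SurplusLinkage
import Literature.NumberTheory.Transcendental.PeriodsWave0Proofs
import Literature.Barriers.Schanuel.LargeTranscendenceDegreeSmallTrdegProofs

/-!
# Disproof of NonlinearLinkage — findings: NO KILL at birth (crux-attack, refuter, 2026-08-17)

Crux `Summit.Schanuel.Schanuel.Theses.SurplusLinkage.NonlinearLinkage` (item stmt-Schanuel-18995, residual conjunct of
route-Schanuel-SurplusLinkage): for ℚ-l.i. `z : Fin n → ℂ` with surplus `a + b ≥ n` (hσ) and Baker-over-L
`d + b ≥ n + 1` (hB), `c = trdeg ℚ(z, e^z) ≥ n`; here a = trdeg ℚ(z), b = trdeg ℚ(e^z), L = ℚ(e^z)^alg ∩ ℂ,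
d = dim_L span_L(1, z).

Findings (kernel-checked below unless marked "paper"):
* S → C (`nonlinearLinkage_of_schanuel`): the conclusion IS Schanuel's conclusion at the same tuple, so the crux is
  unrefutable short of refuting Schanuel; no finite / decidable falsifier exists.
* NON-VACUITY (`nonlinearLinkage_hyps_satisfiable`): at n = 1, z = 1 both hypotheses hold (Hermite only), and the
  instance holds (`nonlinearLinkage_at_one`). Elaboration: rc 0; `simp_all`/`aesop`/`exact?`/`norm_num`/`gcongr`/`decide`
  all fail on the unfolded goal; `False` is not derivable from the hypotheses by `aesop`; the bare conclusion is Schanuel.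
* TIGHTNESS (`nonlinearLinkage_conclusion_tight_at_one`): the conclusion cannot be strengthened to `n + 1 ≤ c`.
* LOAD-BEARING (paper): dropping hσ makes the statement contain AIL (b = 0: Baker gives r = 0 ≤ b, so it reads
  "ℚ-l.i. logs of algebraic numbers are algebraically independent"); dropping hB makes it the linkage bound
  χ ≤ max(σ,0) (contains e ⊥ π, e^e). Neither `_false_without_` is provable today (each needs an open transcendence fact
  to fail), so no `Without` theorem is stated.
* PADDING NORMAL FORM (paper): with m generic pairs (w_i, e^{w_i}) adjoined, (a,b,c,d,n) ↦ (a+m, b+m, c+2m, d+m, n+m)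
  (L(z)/L regular and free from L(e^w) ⇒ linearly disjoint), whence
  NonlinearLinkage ⟺ ∀ ℚ-l.i. z, c ≥ n ∨ c = a + b ∨ t ≥ d − 1 (t = trdeg_L L(z) = c − b):
  "every Schanuel failure is linkage-free or L-affine-generic". The thresholds σ ≥ 0, r ≤ b are not intrinsic.
* C → S: no cheap reduction found (generic / algebraic / logarithmic padding never manufactures nonlinear L-linkage
  from a product-type failure); consistent with the planner's "declared residual".
* Trivial layers (paper, agree with planner): n ≤ 2, b = 0, b = n, a ≥ n. Content starts at n = 3, 1 ≤ b ≤ n − 1,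
  t ≤ d − 2 (normal form (u, u², u³ + ℓ)).
-/

namespace Summit.Schanuel.Schanuel.Cruxes.NonlinearLinkage.Disproof

open Summit.Schanuel.Schanuel.Theses.SurplusLinkage

/-- S → C: `Schanuel → NonlinearLinkage` (drop both hypotheses). [folklore] -/
theorem nonlinearLinkage_of_schanuel (h : _root_.Schanuel) : NonlinearLinkage :=
  fun n z hz _ _ => h n z hz

/-- Refuter's form of S → C: any refutation of the crux refutes the summit. [folklore] -/
theorem not_schanuel_of_not_nonlinearLinkage (h : ¬ NonlinearLinkage) : ¬ _root_.Schanuel :=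
  fun hS => h (nonlinearLinkage_of_schanuel hS)

/-- A transcendental element of an intermediate field forces positive transcendence degree. [folklore] -/
theorem one_le_trdeg_of_transcendental_mem {L : IntermediateField ℚ ℂ} {w : ℂ} (hw : w ∈ L)
    (ht : Transcendental ℚ w) : (1 : Cardinal) ≤ Algebra.trdeg ℚ L := by
  haveI : Algebra.Transcendental ℚ L :=
    ⟨⟨⟨w, hw⟩, fun h => ht (IntermediateField.isAlgebraic_iff.mp h)⟩⟩
  exact Cardinal.one_le_iff_pos.mpr (trdeg_pos ℚ L)

/-- NON-VACUITY of the crux's hypotheses (with `0 < n`): witnessed by `n = 1`, `z = 1`. [folklore] -/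
theorem nonlinearLinkage_hyps_satisfiable :
    ∃ (n : ℕ) (z : Fin n → ℂ), 0 < n ∧ LinearIndependent ℚ z ∧
      (n : Cardinal) ≤ Algebra.trdeg ℚ ↥(IntermediateField.adjoin ℚ (Set.range z)) + Algebra.trdeg ℚ ↥(IntermediateField.adjoin ℚ (Set.range (Complex.exp ∘ z))) ∧
      ((n + 1 : ℕ) : Cardinal) ≤ Module.rank ↥((algebraicClosure ↥(IntermediateField.adjoin ℚ (Set.range (Complex.exp ∘ z))) ℂ).restrictScalars ℚ) ↥(Submodule.span ↥((algebraicClosure ↥(IntermediateField.adjoin ℚ (Set.range (Complex.exp ∘ z))) ℂ).restrictScalars ℚ) (Set.range fun o : Option (Fin n) => o.elim (1 : ℂ) z)) + Algebra.trdeg ℚ ↥(IntermediateField.adjoin ℚ (Set.range (Complex.exp ∘ z))) := by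
  refine ⟨1, fun _ => 1, Nat.one_pos, ?_, ?_, ?_⟩
  · exact linearIndependent_unique_iff.mpr (by simp)
  · have hmemB : Complex.exp 1 ∈ IntermediateField.adjoin ℚ (Set.range (Complex.exp ∘ fun _ : Fin 1 => (1 : ℂ))) :=
      IntermediateField.subset_adjoin ℚ _ ⟨0, rfl⟩
    exact_mod_cast le_add_left (one_le_trdeg_of_transcendental_mem hmemB
      Literature.NumberTheory.Transcendental.transcendental_rat_cexp_one)
  · have hmemB : Complex.exp 1 ∈ IntermediateField.adjoin ℚ (Set.range (Complex.exp ∘ fun _ : Fin 1 => (1 : ℂ))) :=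
      IntermediateField.subset_adjoin ℚ _ ⟨0, rfl⟩
    have hb := one_le_trdeg_of_transcendental_mem hmemB
      Literature.NumberTheory.Transcendental.transcendental_rat_cexp_one
    set L := (algebraicClosure ↥(IntermediateField.adjoin ℚ (Set.range (Complex.exp ∘ fun _ : Fin 1 => (1 : ℂ)))) ℂ).restrictScalars ℚ
    have h1 : (1 : ℂ) ∈ Submodule.span ↥L (Set.range fun o : Option (Fin 1) => o.elim (1 : ℂ) fun _ : Fin 1 => (1 : ℂ)) :=
      Submodule.subset_span ⟨none, rfl⟩
    haveI : Nontrivial ↥(Submodule.span ↥L (Set.range fun o : Option (Fin 1) => o.elim (1 : ℂ) fun _ : Fin 1 => (1 : ℂ))) :=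
      ⟨⟨⟨1, h1⟩, 0, by simp⟩⟩
    have hr : (1 : Cardinal) ≤ Module.rank ↥L ↥(Submodule.span ↥L (Set.range fun o : Option (Fin 1) => o.elim (1 : ℂ) fun _ : Fin 1 => (1 : ℂ))) :=
      Cardinal.one_le_iff_pos.mpr rank_pos
    calc ((1 + 1 : ℕ) : Cardinal) = 1 + 1 := by push_cast; exact one_add_one_eq_two.symm
      _ ≤ _ := add_le_add hr hb

/-- The crux's own instance at `n = 1`, `z = 1` (its conclusion `trdeg ℚ(1, e) ≥ 1` holds; Hermite). [folklore] -/
theorem nonlinearLinkage_at_one :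
    ((1 : ℕ) : Cardinal) ≤ Algebra.trdeg ℚ ↥(IntermediateField.adjoin ℚ (Set.range (fun _ : Fin 1 => (1 : ℂ)) ∪ Set.range (Complex.exp ∘ fun _ : Fin 1 => (1 : ℂ)))) := by
  have hmemC : Complex.exp 1 ∈ IntermediateField.adjoin ℚ (Set.range (fun _ : Fin 1 => (1 : ℂ)) ∪ Set.range (Complex.exp ∘ fun _ : Fin 1 => (1 : ℂ))) :=
    IntermediateField.subset_adjoin ℚ _ (Or.inr ⟨0, rfl⟩)
  exact_mod_cast one_le_trdeg_of_transcendental_mem hmemC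
    Literature.NumberTheory.Transcendental.transcendental_rat_cexp_one

/-- TIGHTNESS: the conclusion of the crux cannot be strengthened to `n + 1 ≤ trdeg ℚ(z, e^z)`:
at `n = 1`, `z = 1` the field `ℚ(1, e) ≤ ℚ(e)` has transcendence degree ≤ 1. [folklore] -/
theorem nonlinearLinkage_conclusion_tight_at_one :
    ¬ ((1 + 1 : ℕ) : Cardinal) ≤ Algebra.trdeg ℚ ↥(IntermediateField.adjoin ℚ (Set.range (fun _ : Fin 1 => (1 : ℂ)) ∪ Set.range (Complex.exp ∘ fun _ : Fin 1 => (1 : ℂ)))) := by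
  intro h
  have hsub : (Set.range (fun _ : Fin 1 => (1 : ℂ)) ∪ Set.range (Complex.exp ∘ fun _ : Fin 1 => (1 : ℂ))) ⊆
      (IntermediateField.adjoin ℚ ({Complex.exp 1} : Set ℂ) : Set ℂ) := by
    rintro x (⟨i, rfl⟩ | ⟨i, rfl⟩)
    · simp
    · simp only [Function.comp_apply, SetLike.mem_coe]
      exact IntermediateField.subset_adjoin ℚ ({Complex.exp 1} : Set ℂ) rfl
  have hle : Algebra.trdeg ℚ ↥(IntermediateField.adjoin ℚ (Set.range (fun _ : Fin 1 => (1 : ℂ)) ∪ Set.range (Complex.exp ∘ fun _ : Fin 1 => (1 : ℂ)))) ≤ 1 :=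
    (Literature.Barriers.Schanuel.trdeg_mono (IntermediateField.adjoin_le_iff.mpr hsub)).trans
      (Literature.Barriers.Schanuel.trdeg_adjoin_singleton_le_one _)
  have : ((1 + 1 : ℕ) : Cardinal) ≤ 1 := h.trans hle
  norm_num at this

end Summit.Schanuel.Schanuel.Cruxes.NonlinearLinkage.Disproof
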